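import Mathlib.Analysis.SpecialFunctions.Complex.Log
import Mathlib.Analysis.Real.Pi.Bounds
import Mathlib.Algebra.MvPolynomial.Funext
import Mathlib.Combinatorics.Pigeonhole
import Mathlib.LinearAlgebra.FiniteDimensional.Lemmas
import Mathlib.RingTheory.PrincipalIdealDomain
import Mathlib.Algebra.EuclideanDomain.Int
import Literature.NumberTheory.Transcendental.PhilipponZeroEstimateP1n
import Literature.NumberTheory.Transcendental.DiazZeroLemma
import Literature.NumberTheory.Transcendental.DiazThm1Proofs
import HarnessLib

/-!
# Diaz's zero lemma from Philippon's zero estimate (Diaz 1989, §II-3-4, pp. 11–12)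

Topic `Literature/NumberTheory/Transcendental`. This file DISCHARGES, relative to Philippon's
zero estimate, the named fact `Literature.NumberTheory.Transcendental.Diaz1989_zeroLemma`
(`DiazZeroLemma.lean`: the "Lemme de zéros" of G. Diaz, J. Number Theory 31 (1989), pp. 11–12,
"celui de P. Philippon, adapté à la situation présente par M. Waldschmidt"): we prove
`Diaz1989_zeroLemma_of_P1n : Philippon1986_GaGm_P1n → Diaz1989_zeroLemma`, where
`Philippon1986_GaGm_P1n` (`PhilipponZeroEstimateP1n.lean`) is Philippon 1986, Théorème 2.1, for
`G = 𝔾ₐ × 𝔾ₘⁿ ⊂ ℙ¹ × (ℙ¹)ⁿ` with the degree clause. Together with `DiazThm1Proofs.lean` this gives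
`diaz_1989_of_philippon : Philippon1986_mainCriterion → Philippon1986_GaGm_P1n → diaz_1989`:
the Gelfond–Diaz ladder `trdeg ℚ(α^β, …, α^{β^{d-1}}) ≥ [(d+1)/2]` now rests exactly on Philippon's
two theorems of 1986 (the criterion, Publ. IHÉS 64, Thm 2.11, and the zero estimate, Bull. SMF 114,
Thm 2.1), both vendored as named facts in the form printed.

## The proof (a reconstruction of Waldschmidt's adaptation; constant `c(n) = 1`)

Data as in Diaz's lemma: `n ≥ 1`, `m ≥ 2`, reals `S, V, D₀, D₁, Δ > 0`, `θ_k, z_hk ∈ ℂ` with (10)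
`∑|z_hk - u_hv_k| < e^{-V}`, `∑|θ_k - v_k| < e^{-V}`, `∑|z_hk| ≤ Δ`, `π|u₁| ≤ Δ`, `π ≤ Δ`, a non-zero
`P ∈ ℂ[W₀, …, W_n]`, `deg_{W₀} ≤ D₀`, `deg_{W_h} ≤ D₁`, vanishing at
`(μ.θ, (e^{μ.z_h})_h)` for `μ ∈ ℕ^m`, `|μ| < S + 1`, and (11): `D₀, D₁ ≥ 1`,
`(n+1)! D₀D₁ⁿ < (S/(n+1))^m`, `(n+1)D₁ < (S/(n+1))^{m-1}` (so `s = S/(n+1) > 1`).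

* (`sig`, Step 1–2) Put `B = [s]` and `σ(ν) = exp_G(ν.θ, (ν.z_h)_h) ∈ G(ℂ)` for `ν ∈ ℤ^m`, a
  homomorphism; `Σ₀ = σ([0, B]^m) ∋ e` is finite and `Σ₀(n+1) ⊆ σ({|μ| ≤ (n+1)B ≤ S})`, where `P`
  vanishes (`e^{∑} = ∏ e`). Apply `Philippon1986_GaGm_P1n.vanishing` with `[D₀], [D₁]`: a connected
  algebraic subgroup `G' = V × T_A` in a translate of `𝒵(P)` with the counts (i), (ii) and the degree
  clause (iii).
* (`sig_mem_iff`, `hcong`) Two points `μ, μ'` of the box have the same class mod `G'` iff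
  `ν = μ' - μ` satisfies `ν.θ = 0` when `V = 0` and `χ.(ν.z) := ∑_j χ_j ∑_k ν_k z_jk ∈ 2πiℤ` for all
  `χ ∈ A`; then `|ν_k| ≤ B`. By (i), `#classes ≤ (n+1)! [D₀][D₁]ⁿ < s^m < (B+1)^m = #box`, so a
  congruent pair `μ ≠ μ'` exists (pigeonhole).
* Case `V = 0`: `ν.v = ν.(v - θ)` has `|ν.v| ≤ B e^{-V}`, and `(λ, μ) = (e₁, ν)` satisfies (12):
  `|λ| = 1`, `|μ| ≤ B ≤ s`, `|λ.u||μ.v| ≤ |u₁| B e^{-V} ≤ (Δ/π) s e^{-V}`.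
* Case `V = 𝔾ₐ`: `A ≠ 0` (else `G' = G ⊆` a translate of `𝒵(P)` and `P` would vanish on
  `ℂ × (ℂˣ)ⁿ`, forcing `P = 0`: `eq_zero_of_forall_evalAt`), so by (iii) some `λ₁ ∈ A`, `λ₁ ≠ 0`,
  `|λ₁,h| ≤ D₁`. If (iii) also provides `λ₂` rationally independent of `λ₁`, write
  `λᵢ.(ν.z) = 2πitᵢ`, `2π|tᵢ| ≤ D₁BΔ` (`abs_t_le`); `λ = t₂λ₁ - t₁λ₂ ≠ 0` (or `λ₁` if `t₁ = 0`) has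
  `λ.(ν.z) = 0`, `|λ_h| ≤ D₁²BΔ/π + D₁`, and `μ = ν`. Otherwise every element of `A` is rationally
  dependent on `λ₁` (`depSubgroup`), so the saturated `A` is cyclic, `A = ℤλ₀`
  (`eq_zmultiples_of_saturated`, via Bezout for the coordinates of `λ₁`), and (ii) improves the count
  to `#classes ≤ (n+1)[D₁] < s^{m-1} < (B+1)^{m-1}`; hence some class has more than `B + 1` points of
  the box and is therefore not on a line (`exists_indep_of_card_gt`): it contains `μ₀, μ₁, μ₂` with
  `ν = μ₁ - μ₀`, `ν' = μ₂ - μ₀` independent; with `λ₁.(ν.z) = 2πit`, `λ₁.(ν'.z) = 2πit'`, the vector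
  `μ = t'ν - tν' ≠ 0` (or `ν` if `t = 0`) has `λ₁.(μ.z) = 0`, `|μ_k| ≤ D₁B²Δ/π + B`, and `λ = λ₁`.
  In both sub-cases `λ.u · μ.v = ∑ λ_hμ_k(u_hv_k - z_hk) + λ.(μ.z)` (`norm_mul_norm_le`), so
  `|λ.u||μ.v| ≤ max|λ_h| max|μ_k| e^{-V}`, and the bounds (12) hold with `c = 1` (using `Δ ≥ π > 3`,
  `D₁ ≥ 1`, `s > 1`, `B ≤ s`).

The linear independence of the `uᵢ` and of the `vⱼ` (hypotheses of the printed lemma) is not used.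
Everything here is proved; `#print axioms` is the whitelist.

## References

* G. Diaz, *Grands degrés de transcendance pour des familles d'exponentielles*, J. Number Theory
  31 (1989), 1–23, §II-3-4, Lemme de zéros, (10)–(12), pp. 11–12.
* P. Philippon, *Lemmes de zéros dans les groupes algébriques commutatifs*, Bull. Soc. Math.
  France 114 (1986), 355–383, Théorème 2.1.
* Yu. V. Nesterenko, P. Philippon (eds.), *Introduction to Algebraic Independence Theory*,
  LNM 1752, Springer 2001, Ch. 14, §3.2.3, Lemma 3.5 and Prop. 3.6 (pp. 253–254: the pattern of the
  argument in the real, multiplicity-free torus case).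
-/

noncomputable section

namespace Literature.NumberTheory.Transcendental

open Finset GaGm

namespace DiazZL

variable {n m : ℕ}

/-! ### The one-parameter points `σ(ν) = exp_G(ν.θ, (ν.z_h)_h)` -/

/-- The Lie-algebra point `w(ν) = (∑_k ν_kθ_k, (∑_k ν_k z_hk)_h)`. [cite: Diaz1989, §II-3-4 p. 12] -/
def wv (θ : Fin m → ℂ) (z : Fin n → Fin m → ℂ) (ν : Fin m → ℤ) : ℂ × (Fin n → ℂ) :=
  (∑ k, (ν k : ℂ) * θ k, fun h => ∑ k, (ν k : ℂ) * z h k)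

/-- `w` is additive. [folklore] -/
theorem wv_add (θ : Fin m → ℂ) (z : Fin n → Fin m → ℂ) (ν ν' : Fin m → ℤ) :
    wv θ z (ν + ν') = wv θ z ν + wv θ z ν' := by
  ext <;> simp [wv, add_mul, Finset.sum_add_distrib]

/-- `w(0) = 0`. [folklore] -/
@[simp] theorem wv_zero (θ : Fin m → ℂ) (z : Fin n → Fin m → ℂ) : wv θ z 0 = 0 := by
  ext <;> simp [wv]

/-- The points `σ(ν) = exp_G(w(ν)) ∈ G(ℂ)`. [cite: Diaz1989, §II-3-4 p. 12] -/
def sig (θ : Fin m → ℂ) (z : Fin n → Fin m → ℂ) (ν : Fin m → ℤ) : GaGm n :=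
  GaGm.exp (wv θ z ν)

/-- `σ` is a homomorphism. [folklore] -/
theorem sig_add (θ : Fin m → ℂ) (z : Fin n → Fin m → ℂ) (ν ν' : Fin m → ℤ) :
    sig θ z (ν + ν') = sig θ z ν * sig θ z ν' := by
  rw [sig, wv_add, GaGm.exp_add]; rfl

/-- `σ(0) = e`. [folklore] -/
@[simp] theorem sig_zero (θ : Fin m → ℂ) (z : Fin n → Fin m → ℂ) : sig θ z 0 = 1 := by
  simp [sig]

/-- `σ(ν)⁻¹ σ(ν') = σ(ν' - ν)`. [folklore] -/
theorem sig_inv_mul (θ : Fin m → ℂ) (z : Fin n → Fin m → ℂ) (ν ν' : Fin m → ℤ) :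
    (sig θ z ν)⁻¹ * sig θ z ν' = sig θ z (ν' - ν) := by
  rw [inv_mul_eq_iff_eq_mul, ← sig_add]; congr 1; abel

/-- `σ(∑ᵢ νᵢ) = ∏ᵢ σ(νᵢ)`. [folklore] -/
theorem sig_sum (θ : Fin m → ℂ) (z : Fin n → Fin m → ℂ) {ι : Type*} (s : Finset ι)
    (ν : ι → Fin m → ℤ) : sig θ z (∑ i ∈ s, ν i) = ∏ i ∈ s, sig θ z (ν i) := by
  classical
  induction s using Finset.induction_on with
  | empty => simp
  | insert a s ha ih => rw [Finset.sum_insert ha, Finset.prod_insert ha, sig_add, ih]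

/-- Coordinates of `exp_G(w)`: `(w₀, e^{w₁}, …, e^{w_n})`. [folklore] -/
theorem coord_exp (w : ℂ × (Fin n → ℂ)) :
    coord (GaGm.exp w) = Fin.cons w.1 fun h => Complex.exp (w.2 h) := by
  ext i
  refine Fin.cases ?_ (fun h => ?_) i
  · simp [GaGm.exp]
  · simp [GaGm.exp]

/-- The torus condition for `exp_G(w)` and a character `χ`: `∏_j (e^{w_j})^{χ_j} = 1` iff
`∑_j χ_j w_j ∈ 2πiℤ`. [folklore] -/
theorem prod_zpow_exp_eq_one_iff (w : Fin n → ℂ) (χ : Fin n → ℤ) :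
    (∏ j, ((GaGm.exp ((0 : ℂ), w)).2 j) ^ (χ j) = 1) ↔
      ∃ t : ℤ, ∑ j, (χ j : ℂ) * w j = t * (2 * Real.pi * Complex.I) := by
  rw [← Units.val_eq_one, Units.coe_prod]
  have e : ∀ j, (((GaGm.exp ((0 : ℂ), w)).2 j ^ χ j : ℂˣ) : ℂ) = Complex.exp ((χ j : ℂ) * w j) := by
    intro j
    rw [Units.val_zpow_eq_zpow_val]
    simp [GaGm.exp, Complex.exp_int_mul]
  simp_rw [e, ← Complex.exp_sum]
  exact Complex.exp_eq_one_iff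

/-- Membership of `σ(ν)` in `G' = V × T_A`: `ν.θ = 0` if `V = 0`, and `∑_j χ_j (ν.z)_j ∈ 2πiℤ`
for all `χ ∈ A`. [folklore] -/
theorem sig_mem_iff (H : ConnAlgSubgroup n) (θ : Fin m → ℂ) (z : Fin n → Fin m → ℂ)
    (ν : Fin m → ℤ) :
    sig θ z ν ∈ H.toSubgroup ↔
      (H.addPart = false → ∑ k, (ν k : ℂ) * θ k = 0) ∧
        ∀ χ ∈ H.chars, ∃ t : ℤ,
          ∑ j, (χ j : ℂ) * ∑ k, (ν k : ℂ) * z j k = t * (2 * Real.pi * Complex.I) := by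
  show ((H.addPart = false → (sig θ z ν).1 = 1) ∧
    ∀ χ ∈ H.chars, ∏ j, ((sig θ z ν).2 j) ^ (χ j) = 1) ↔ _
  have h1 : ((sig θ z ν).1 = 1) ↔ ∑ k, (ν k : ℂ) * θ k = 0 := by
    rw [show (sig θ z ν).1 = Multiplicative.ofAdd (∑ k, (ν k : ℂ) * θ k) from rfl, ofAdd_eq_one]
  have h2 : ∀ χ : Fin n → ℤ, (∏ j, ((sig θ z ν).2 j) ^ (χ j) = 1) ↔
      ∃ t : ℤ, ∑ j, (χ j : ℂ) * ∑ k, (ν k : ℂ) * z j k = t * (2 * Real.pi * Complex.I) := by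
    intro χ
    exact prod_zpow_exp_eq_one_iff (fun h => ∑ k, (ν k : ℂ) * z h k) χ
  rw [h1]
  constructor
  · rintro ⟨ha, hb⟩
    exact ⟨ha, fun χ hχ => (h2 χ).mp (hb χ hχ)⟩
  · rintro ⟨ha, hb⟩
    exact ⟨ha, fun χ hχ => (h2 χ).mpr (hb χ hχ)⟩

/-! ### A polynomial vanishing on `G(ℂ) = ℂ × (ℂˣ)ⁿ` is zero -/

/-- If `P ∈ ℂ[X, Y₁, …, Y_n]` vanishes at every point of `G(ℂ) = ℂ × (ℂˣ)ⁿ` then `P = 0`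
(`P · ∏ Y_h` vanishes on all of `ℂ^{n+1}`). [folklore] -/
theorem eq_zero_of_forall_evalAt (P : MvPolynomial (Fin (n + 1)) ℂ)
    (h : ∀ g : GaGm n, evalAt P g = 0) : P = 0 := by
  set Q : MvPolynomial (Fin (n + 1)) ℂ := P * ∏ j : Fin n, MvPolynomial.X j.succ with hQ
  have hQ0 : Q = 0 := by
    apply MvPolynomial.funext
    intro x
    rw [map_zero, hQ, map_mul, map_prod]
    by_cases hx : ∀ j : Fin n, x j.succ ≠ 0
    · let g : GaGm n := (Multiplicative.ofAdd (x 0), fun j => Units.mk0 (x j.succ) (hx j))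
      have hc : coord g = x := by
        ext i
        refine Fin.cases ?_ (fun j => ?_) i
        · simp [g]
        · simp [g]
      have := h g
      rw [evalAt, hc] at this
      rw [this, zero_mul]
    · push Not at hx
      obtain ⟨j, hj⟩ := hx
      have : ∏ j : Fin n, MvPolynomial.eval x (MvPolynomial.X (R := ℂ) j.succ) = 0 :=
        Finset.prod_eq_zero (Finset.mem_univ j) (by simp [hj])
      rw [this, mul_zero]
  have hprod : (∏ j : Fin n, MvPolynomial.X (R := ℂ) (j.succ : Fin (n + 1))) ≠ 0 :=
    Finset.prod_ne_zero_iff.mpr fun j _ => MvPolynomial.X_ne_zero _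
  rcases mul_eq_zero.mp (hQ ▸ hQ0 : P * ∏ j : Fin n, MvPolynomial.X j.succ = 0) with hP | hP
  · exact hP
  · exact absurd hP hprod


/-! ### Lattice points in a box: a large class is not on a line -/

/-- A set of lattice points of the box `[0, B]^m` with more than `B + 1` elements contains three
points `μ₀, μ₁, μ₂` with `μ₁ - μ₀`, `μ₂ - μ₀` linearly independent (a line meets the box in at
most `B + 1` lattice points). [folklore] -/
theorem exists_indep_of_card_gt {C : Finset (Fin m → ℕ)} {B : ℕ} (hC : ∀ μ ∈ C, ∀ k, μ k ≤ B)
    (hcard : B + 1 < C.card) :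
    ∃ μ₀ ∈ C, ∃ μ₁ ∈ C, ∃ μ₂ ∈ C, ∀ a b : ℤ,
      (∀ k, a * ((μ₁ k : ℤ) - μ₀ k) + b * ((μ₂ k : ℤ) - μ₀ k) = 0) → a = 0 ∧ b = 0 := by
  classical
  have h2 : 1 < C.card := by omega
  obtain ⟨μ₀, hμ₀, μ₁, hμ₁, hne⟩ := Finset.one_lt_card.mp h2
  obtain ⟨k₀, hk₀⟩ : ∃ k₀, (μ₁ k₀ : ℤ) - μ₀ k₀ ≠ 0 := by
    by_contra h
    push Not at h
    exact hne (funext fun k => by have := h k; omega).symm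
  by_contra hcon
  push Not at hcon
  -- every `μ ∈ C` satisfies a relation `a (μ₁ - μ₀) + b (μ - μ₀) = 0` with `(a, b) ≠ 0`
  have hrel : ∀ μ ∈ C, ∃ a b : ℤ, (∀ k, a * ((μ₁ k : ℤ) - μ₀ k) + b * ((μ k : ℤ) - μ₀ k) = 0) ∧
      b ≠ 0 := by
    intro μ hμ
    obtain ⟨a, b, hab, hne0⟩ := hcon μ₀ hμ₀ μ₁ hμ₁ μ hμ
    refine ⟨a, b, hab, fun hb => ?_⟩
    subst hb
    have ha : a ≠ 0 := fun ha => hne0 ha rfl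
    have := hab k₀
    simp only [zero_mul, add_zero, mul_eq_zero] at this
    tauto
  choose! a b hab hb using hrel
  -- the coordinate `k₀` is injective on `C`
  have hinj : Set.InjOn (fun μ : Fin m → ℕ => μ k₀) ↑C := by
    intro μ hμ μ' hμ' heq
    simp only at heq
    have r1 := hab μ hμ
    have r2 := hab μ' hμ'
    funext j
    -- `b b' ν_{k₀} (μ_j - μ₀_j) = b b' ν_{k₀} (μ'_j - μ₀_j)`
    have e1 := r1 j
    have e2 := r2 j
    have e1' := r1 k₀
    have e2' := r2 k₀
    have hbb : b μ * b μ' * ((μ₁ k₀ : ℤ) - μ₀ k₀) ≠ 0 :=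
      mul_ne_zero (mul_ne_zero (hb μ hμ) (hb μ' hμ')) hk₀
    have key : b μ * b μ' * ((μ₁ k₀ : ℤ) - μ₀ k₀) * ((μ j : ℤ) - μ₀ j) =
        b μ * b μ' * ((μ₁ k₀ : ℤ) - μ₀ k₀) * ((μ' j : ℤ) - μ₀ j) := by
      have hc : (μ k₀ : ℤ) = μ' k₀ := by exact_mod_cast heq
      -- from the relations: b (μ_j - μ₀_j) = -a ν_j, b (μ_{k₀} - μ₀_{k₀}) = -a ν_{k₀}, same for μ'
      have f1 : b μ * ((μ j : ℤ) - μ₀ j) = -(a μ * ((μ₁ j : ℤ) - μ₀ j)) := by linarith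
      have f2 : b μ' * ((μ' j : ℤ) - μ₀ j) = -(a μ' * ((μ₁ j : ℤ) - μ₀ j)) := by linarith
      have g1 : b μ * ((μ k₀ : ℤ) - μ₀ k₀) = -(a μ * ((μ₁ k₀ : ℤ) - μ₀ k₀)) := by linarith
      have g2 : b μ' * ((μ' k₀ : ℤ) - μ₀ k₀) = -(a μ' * ((μ₁ k₀ : ℤ) - μ₀ k₀)) := by linarith
      rw [hc] at g1
      -- `a b' ν_{k₀} = a' b ν_{k₀}` (both equal `-b b' (c - μ₀_{k₀})`)
      have h3 : a μ * b μ' * ((μ₁ k₀ : ℤ) - μ₀ k₀) = a μ' * b μ * ((μ₁ k₀ : ℤ) - μ₀ k₀) := by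
        linear_combination (b μ') * g1 - (b μ) * g2
      calc b μ * b μ' * ((μ₁ k₀ : ℤ) - μ₀ k₀) * ((μ j : ℤ) - μ₀ j)
          = b μ' * ((μ₁ k₀ : ℤ) - μ₀ k₀) * (b μ * ((μ j : ℤ) - μ₀ j)) := by ring
        _ = -(a μ * b μ' * ((μ₁ k₀ : ℤ) - μ₀ k₀)) * ((μ₁ j : ℤ) - μ₀ j) := by rw [f1]; ring
        _ = -(a μ' * b μ * ((μ₁ k₀ : ℤ) - μ₀ k₀)) * ((μ₁ j : ℤ) - μ₀ j) := by rw [h3]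
        _ = b μ * ((μ₁ k₀ : ℤ) - μ₀ k₀) * (b μ' * ((μ' j : ℤ) - μ₀ j)) := by rw [f2]; ring
        _ = _ := by ring
    have := mul_left_cancel₀ hbb key
    have : (μ j : ℤ) = μ' j := by linarith
    exact_mod_cast this
  have hmaps : ∀ μ ∈ C, (fun μ : Fin m → ℕ => μ k₀) μ ∈ Finset.range (B + 1) := fun μ hμ =>
    Finset.mem_range.mpr (Nat.lt_succ_of_le (hC μ hμ k₀))
  have := Finset.card_le_card_of_injOn _ hmaps hinj
  rw [Finset.card_range] at this
  omega

/-! ### Saturated subgroups of `ℤⁿ` of rank one are cyclic -/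

/-- The elements rationally dependent on a fixed `λ` form a subgroup of `ℤⁿ`. [folklore] -/
def depSubgroup (lam : Fin n → ℤ) : AddSubgroup (Fin n → ℤ) where
  carrier := {χ | ∃ a b : ℤ, b ≠ 0 ∧ b • χ = a • lam}
  zero_mem' := ⟨0, 1, one_ne_zero, by simp⟩
  add_mem' := by
    rintro χ χ' ⟨a, b, hb, h⟩ ⟨a', b', hb', h'⟩
    refine ⟨a * b' + a' * b, b * b', mul_ne_zero hb hb', ?_⟩
    rw [smul_add, mul_comm b b', mul_smul, h, ← mul_smul, mul_comm b' b, mul_smul b b', h',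
      ← mul_smul, add_smul]
    congr 1 <;> rw [mul_comm] 
  neg_mem' := by
    rintro χ ⟨a, b, hb, h⟩
    exact ⟨-a, b, hb, by rw [smul_neg, h, neg_smul]⟩

/-- Membership in `depSubgroup`. [folklore] -/
theorem mem_depSubgroup_iff (lam χ : Fin n → ℤ) :
    χ ∈ depSubgroup lam ↔ ∃ a b : ℤ, b ≠ 0 ∧ b • χ = a • lam := Iff.rfl

/-- `depSubgroup` is saturated. [folklore] -/
theorem mem_depSubgroup_of_smul (lam : Fin n → ℤ) {k : ℤ} (hk : k ≠ 0) {χ : Fin n → ℤ}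
    (h : k • χ ∈ depSubgroup lam) : χ ∈ depSubgroup lam := by
  obtain ⟨a, b, hb, h⟩ := h
  exact ⟨a, b * k, mul_ne_zero hb hk, by rw [mul_smul, h]⟩

/-- **A saturated subgroup of `ℤⁿ` all of whose elements are rationally dependent on one non-zero
element `λ` is cyclic**, generated by the primitive vector `λ/gcd(λ)`. [folklore] -/
theorem eq_zmultiples_of_saturated {A : AddSubgroup (Fin n → ℤ)}
    (hsat : ∀ (k : ℤ) (χ : Fin n → ℤ), k ≠ 0 → k • χ ∈ A → χ ∈ A)
    {lam : Fin n → ℤ} (hlam : lam ∈ A) (hlam0 : lam ≠ 0) (hdep : A ≤ depSubgroup lam) :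
    ∃ lam₀ : Fin n → ℤ, A = AddSubgroup.zmultiples lam₀ := by
  classical
  -- the ideal generated by the coordinates of `λ` is principal, `= (d)`
  set I : Ideal ℤ := Ideal.span (Set.range lam) with hI
  have hIp : I.IsPrincipal := IsPrincipalIdealRing.principal I
  set d : ℤ := Submodule.IsPrincipal.generator I with hd
  have hId : I = Ideal.span {d} := (Ideal.span_singleton_generator I).symm
  have hdvd : ∀ h, d ∣ lam h := fun h => by
    rw [← Ideal.mem_span_singleton, ← hId]
    exact Ideal.subset_span ⟨h, rfl⟩
  have hd0 : d ≠ 0 := by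
    intro h0
    apply hlam0
    funext h
    have := hdvd h
    rw [h0, zero_dvd_iff] at this
    simpa using this
  -- Bezout: `d = ∑ c_h λ_h`
  have hdmem : d ∈ I := by rw [hId]; exact Ideal.mem_span_singleton_self d
  obtain ⟨c, hc⟩ := Ideal.mem_span_range_iff_exists_fun.mp hdmem
  -- the primitive vector `λ₀ = λ/d`
  choose q hq using hdvd
  refine ⟨q, le_antisymm ?_ ?_⟩
  · -- `A ≤ ℤλ₀`
    intro χ hχ
    obtain ⟨a, b, hb, hrel⟩ := hdep hχ
    have hbez : ∑ h, c h * q h = 1 := by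
      have : d * ∑ h, c h * q h = d * 1 := by
        rw [mul_one, Finset.mul_sum]
        conv_rhs => rw [← hc]
        refine Finset.sum_congr rfl fun h _ => ?_
        rw [hq h]; ring
      exact mul_left_cancel₀ hd0 this
    -- `t = ∑ c_h χ_h` works: `b χ_h = a d q_h` and `b t = a d`
    set t : ℤ := ∑ h, c h * χ h with ht
    have hcoord : ∀ h, b * χ h = a * (d * q h) := fun h => by
      have := congrFun hrel h
      simp only [Pi.smul_apply, smul_eq_mul] at this
      rw [this, hq h]
    have hbt : b * t = a * d := by
      rw [ht, Finset.mul_sum]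
      calc ∑ h, b * (c h * χ h) = ∑ h, c h * (a * (d * q h)) := by
            refine Finset.sum_congr rfl fun h _ => ?_
            rw [← hcoord h]; ring
        _ = a * d * ∑ h, c h * q h := by rw [Finset.mul_sum]; refine Finset.sum_congr rfl fun h _ => ?_; ring
        _ = a * d := by rw [hbez, mul_one]
    refine AddSubgroup.mem_zmultiples_iff.mpr ⟨t, ?_⟩
    funext h
    simp only [Pi.smul_apply, smul_eq_mul]
    have : b * (t * q h) = b * χ h := by rw [hcoord h, ← mul_assoc, hbt]; ring
    exact mul_left_cancel₀ hb this
  · -- `ℤλ₀ ≤ A`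
    rw [AddSubgroup.zmultiples_le]
    refine hsat d q hd0 ?_
    have : d • q = lam := by
      funext h; simp [hq h]
    rw [this]; exact hlam

/-! ### Two elementary estimates -/

/-- If `∑_j χ_j (∑_k ν_k z_jk) = 2πi t` with `|χ_j| ≤ D₁`, `|ν_k| ≤ B`, then
`2π|t| ≤ D₁ B ∑|z_jk|`. [folklore] -/
theorem abs_t_le {χ : Fin n → ℤ} {ν : Fin m → ℤ} {z : Fin n → Fin m → ℂ} {t : ℤ} {D₁ B : ℝ}
    (hχ : ∀ j, (|χ j| : ℝ) ≤ D₁) (hν : ∀ k, (|ν k| : ℝ) ≤ B) (hD : 0 ≤ D₁)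
    (h : ∑ j, (χ j : ℂ) * ∑ k, (ν k : ℂ) * z j k = t * (2 * Real.pi * Complex.I)) :
    2 * Real.pi * |(t : ℝ)| ≤ D₁ * B * ∑ j, ∑ k, ‖z j k‖ := by
  have hn : ‖(t : ℂ) * (2 * Real.pi * Complex.I)‖ = 2 * Real.pi * |(t : ℝ)| := by
    rw [norm_mul]
    simp [Complex.norm_real, abs_of_pos Real.pi_pos]
    ring
  rw [← hn, ← h]
  calc ‖∑ j, (χ j : ℂ) * ∑ k, (ν k : ℂ) * z j k‖ ≤ ∑ j, ‖(χ j : ℂ) * ∑ k, (ν k : ℂ) * z j k‖ :=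
        norm_sum_le _ _
    _ ≤ ∑ j, D₁ * (B * ∑ k, ‖z j k‖) := Finset.sum_le_sum fun j _ => by
        rw [norm_mul]
        refine mul_le_mul ?_ ?_ (norm_nonneg _) hD
        · have : ‖(χ j : ℂ)‖ = (|χ j| : ℝ) := by
            rw [← Int.cast_abs (R := ℝ)]; simp [Complex.norm_intCast]
          rw [this]; exact hχ j
        · calc ‖∑ k, (ν k : ℂ) * z j k‖ ≤ ∑ k, ‖(ν k : ℂ) * z j k‖ := norm_sum_le _ _
            _ ≤ ∑ k, B * ‖z j k‖ := Finset.sum_le_sum fun k _ => by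
                rw [norm_mul]
                refine mul_le_mul_of_nonneg_right ?_ (norm_nonneg _)
                have : ‖(ν k : ℂ)‖ = (|ν k| : ℝ) := by simp [Complex.norm_intCast]
                rw [this]; exact hν k
            _ = B * ∑ k, ‖z j k‖ := by rw [Finset.mul_sum]
    _ = D₁ * B * ∑ j, ∑ k, ‖z j k‖ := by rw [Finset.mul_sum]; refine Finset.sum_congr rfl fun j _ => ?_; ring

/-- If `∑_h λ_h ∑_k μ_k z_hk = 0` then `|λ.u| · |μ.v| ≤ max|λ_h| · max|μ_k| · ∑|z_hk - u_hv_k|`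
(write `u_hv_k = (u_hv_k - z_hk) + z_hk`). [cite: Diaz1989, §II-3-4 (12) p. 12] -/
theorem norm_mul_norm_le {lam : Fin n → ℤ} {mu : Fin m → ℤ} {u : Fin n → ℂ} {v : Fin m → ℂ}
    {z : Fin n → Fin m → ℂ} {L M : ℝ} (hL : ∀ h, (|lam h| : ℝ) ≤ L) (hM : ∀ k, (|mu k| : ℝ) ≤ M)
    (hL0 : 0 ≤ L) (h0 : ∑ h, (lam h : ℂ) * ∑ k, (mu k : ℂ) * z h k = 0) :
    ‖∑ h, (lam h : ℂ) * u h‖ * ‖∑ k, (mu k : ℂ) * v k‖ ≤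
      L * M * ∑ h, ∑ k, ‖z h k - u h * v k‖ := by
  rw [← norm_mul, Finset.sum_mul_sum]
  have e : ∑ h, ∑ k, (lam h : ℂ) * u h * ((mu k : ℂ) * v k) =
      ∑ h, ∑ k, (lam h : ℂ) * (mu k : ℂ) * (u h * v k - z h k) +
        ∑ h, (lam h : ℂ) * ∑ k, (mu k : ℂ) * z h k := by
    rw [← Finset.sum_add_distrib]
    refine Finset.sum_congr rfl fun h _ => ?_
    rw [Finset.mul_sum, ← Finset.sum_add_distrib]
    refine Finset.sum_congr rfl fun k _ => ?_
    ring
  rw [e, h0, add_zero]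
  calc ‖∑ h, ∑ k, (lam h : ℂ) * (mu k : ℂ) * (u h * v k - z h k)‖
      ≤ ∑ h, ∑ k, ‖(lam h : ℂ) * (mu k : ℂ) * (u h * v k - z h k)‖ :=
        (norm_sum_le _ _).trans (Finset.sum_le_sum fun h _ => norm_sum_le _ _)
    _ ≤ ∑ h, ∑ k, L * M * ‖z h k - u h * v k‖ :=
        Finset.sum_le_sum fun h _ => Finset.sum_le_sum fun k _ => by
          rw [norm_mul, norm_mul, norm_sub_rev]
          have h1 : ‖(lam h : ℂ)‖ = (|lam h| : ℝ) := by simp [Complex.norm_intCast]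
          have h2 : ‖(mu k : ℂ)‖ = (|mu k| : ℝ) := by simp [Complex.norm_intCast]
          rw [h1, h2]
          have hM0 : 0 ≤ M := le_trans (by positivity) (hM k)
          exact mul_le_mul_of_nonneg_right (mul_le_mul (hL h) (hM k) (by positivity) hL0)
            (norm_nonneg _)
    _ = L * M * ∑ h, ∑ k, ‖z h k - u h * v k‖ := by
        rw [Finset.mul_sum]; refine Finset.sum_congr rfl fun h _ => ?_; rw [Finset.mul_sum]


/-! ### The pairing `χ.(ν.z) = ∑_j χ_j ∑_k ν_k z_jk` -/

/-- `⟪χ, ν⟫ = ∑_j χ_j ∑_k ν_k z_jk`. [folklore] -/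
def pair (z : Fin n → Fin m → ℂ) (χ : Fin n → ℤ) (ν : Fin m → ℤ) : ℂ :=
  ∑ j, (χ j : ℂ) * ∑ k, (ν k : ℂ) * z j k

/-- Linearity in `χ`. [folklore] -/
theorem pair_lin_left (z : Fin n → Fin m → ℂ) (a b : ℤ) (χ χ' : Fin n → ℤ) (ν : Fin m → ℤ) :
    pair z (a • χ - b • χ') ν = a * pair z χ ν - b * pair z χ' ν := by
  simp only [pair, Pi.sub_apply, Pi.smul_apply, smul_eq_mul, Int.cast_sub, Int.cast_mul,
    Finset.mul_sum]
  rw [← Finset.sum_sub_distrib]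
  refine Finset.sum_congr rfl fun j _ => ?_
  rw [← Finset.sum_sub_distrib]
  refine Finset.sum_congr rfl fun k _ => ?_
  ring

/-- Linearity in `ν`. [folklore] -/
theorem pair_lin_right (z : Fin n → Fin m → ℂ) (a b : ℤ) (χ : Fin n → ℤ) (ν ν' : Fin m → ℤ) :
    pair z χ (a • ν - b • ν') = a * pair z χ ν - b * pair z χ ν' := by
  simp only [pair, Pi.sub_apply, Pi.smul_apply, smul_eq_mul, Int.cast_sub, Int.cast_mul,
    Finset.mul_sum]
  rw [← Finset.sum_sub_distrib]
  refine Finset.sum_congr rfl fun j _ => ?_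
  rw [← Finset.sum_sub_distrib]
  refine Finset.sum_congr rfl fun k _ => ?_
  ring

/-- Entries of `t₂λ₁ - t₁λ₂`. [folklore] -/
theorem abs_comb_le {ι : Type*} {lam₁ lam₂ : ι → ℤ} {t₁ t₂ : ℤ} {D T : ℝ}
    (h1 : ∀ h, (|lam₁ h| : ℝ) ≤ D) (h2 : ∀ h, (|lam₂ h| : ℝ) ≤ D) (ht1 : (|t₁| : ℝ) ≤ T)
    (ht2 : (|t₂| : ℝ) ≤ T) (h : ι) : (|(t₂ • lam₁ - t₁ • lam₂) h| : ℝ) ≤ 2 * T * D := by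
  have hD : 0 ≤ D := le_trans (by positivity) (h1 h)
  have hT : 0 ≤ T := le_trans (by positivity) ht1
  simp only [Pi.sub_apply, Pi.smul_apply, smul_eq_mul, Int.cast_sub, Int.cast_mul]
  calc |(t₂ : ℝ) * lam₁ h - t₁ * lam₂ h| ≤ |(t₂ : ℝ) * lam₁ h| + |(t₁ : ℝ) * lam₂ h| := abs_sub _ _
    _ = |(t₂ : ℝ)| * |(lam₁ h : ℝ)| + |(t₁ : ℝ)| * |(lam₂ h : ℝ)| := by rw [abs_mul, abs_mul]
    _ ≤ T * D + T * D :=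
        add_le_add (mul_le_mul ht2 (h1 h) (abs_nonneg _) hT) (mul_le_mul ht1 (h2 h) (abs_nonneg _) hT)
    _ = 2 * T * D := by ring


/-! ### The points of Diaz's lemma and the application of the zero estimate -/

/-- From `2π|t| ≤ D₁BZ`, `Z ≤ Δ`: `|t| ≤ D₁BΔ/(2π)`. [folklore] -/
theorem abs_t_le' {t : ℤ} {D₁ B Z Δ : ℝ} (h : 2 * Real.pi * |(t : ℝ)| ≤ D₁ * B * Z) (hZ : Z ≤ Δ)
    (hD : 0 ≤ D₁) (hB : 0 ≤ B) : (|t| : ℝ) ≤ D₁ * B * Δ / (2 * Real.pi) := by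
  rw [le_div_iff₀ (by positivity)]
  calc (|t| : ℝ) * (2 * Real.pi) = 2 * Real.pi * |(t : ℝ)| := by ring
    _ ≤ D₁ * B * Z := h
    _ ≤ D₁ * B * Δ := mul_le_mul_of_nonneg_left hZ (by positivity)

set_option maxHeartbeats 1600000 in
/-- **Diaz's zero lemma from Philippon's zero estimate on `𝔾ₐ × 𝔾ₘⁿ ⊂ (ℙ¹)^{n+1}`** (Diaz 1989,
§II-3-4, pp. 11–12: "Le lemme de zéros que nous utilisons est celui de P. Philippon, adapté à la
situation présente par M. Waldschmidt"), with the constant `c(n) = 1`. Proof: with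
`B = [S/(n+1)]`, the points `σ(μ) = (μ.θ, (e^{μ.z_h})_h)`, `μ ∈ [0, B]^m`, satisfy
`Σ₀(n+1) ⊆ {σ(μ) ; |μ| ≤ S}` where `P` vanishes; the zero estimate yields `G' = V × T_A ≠ G` and the
class count `card((Σ₀G')/G') ≤ (n+1)!D₀D₁ⁿ < #[0,B]^m` ((11), first part), so two points
`μ ≠ μ'` of the box are congruent: `ν = μ' - μ` has `ν.θ = 0` if `V = 0` and `χ.(ν.z) ∈ 2πiℤ` for
`χ ∈ A`. If `V = 0`, `|ν.v| ≤ B e^{-V}` and `(λ, μ) = (e₁, ν)` satisfies (12) (`π|u₁| ≤ Δ`). If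
`V = 𝔾ₐ`, `A ≠ 0` is rationally spanned by characters `λ` with `|λ_h| ≤ D₁` (degree clause):
either two independent ones `λ₁, λ₂` exist, and `λ = t₂λ₁ - t₁λ₂` (`λᵢ.(ν.z) = 2πitᵢ`,
`2π|tᵢ| ≤ D₁BΔ`) has `λ.(ν.z) = 0`; or `A = ℤλ₀` is cyclic, the count improves to
`≤ (n+1)D₁ < #[0,B]^{m-1}` ((11), second part), a class has more than `B + 1` points, hence
contains `μ₀, μ₁, μ₂` with independent `ν = μ₁ - μ₀`, `ν' = μ₂ - μ₀`, and `μ = t'ν - tν'` has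
`λ₁.(μ.z) = 0`. In both cases `|λ.u|·|μ.v| = |∑ λ_hμ_k(u_hv_k - z_hk)| ≤ max|λ_h| max|μ_k| e^{-V}`.
[cite: Diaz1989, §II-3-4 Lemme de zéros, pp. 11–12] -/
theorem zeroLemma_of_P1n (hP : Philippon1986_GaGm_P1n) : Diaz1989_zeroLemma := by
  classical
  intro n hn
  refine ⟨1, one_pos, ?_⟩
  intro m hm S V D₀ D₁ Δ hS hV hD₀ hD₁ hΔ u v _hu _hv θ z h10a h10b h10c h10d h10e P hP0 hdeg₀ hdeg
    hvan h1D₀ h1D₁ h11a h11b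
  -- Step 0: the real parameters `s = S/(n+1) > 1`, `B = [s]`, `D₀' = [D₀]`, `D₁' = [D₁]`.
  have hn0 : (0 : ℝ) ≤ n := Nat.cast_nonneg n
  have hn1 : (0 : ℝ) < n + 1 := by positivity
  set s : ℝ := S / (n + 1) with hs_def
  have hs0 : 0 < s := div_pos hS hn1
  have hs1 : 1 < s := by
    by_contra hle
    push Not at hle
    have h1 : s ^ (m - 1) ≤ 1 := pow_le_one₀ hs0.le hle
    have h2 : (2 : ℝ) ≤ (n + 1) * D₁ := by nlinarith
    linarith
  set B : ℕ := ⌊s⌋₊ with hB_def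
  have hBs : (B : ℝ) ≤ s := Nat.floor_le hs0.le
  have hsB : s < (B : ℝ) + 1 := Nat.lt_floor_add_one s
  have hB1 : 1 ≤ B := by
    rw [hB_def, Nat.le_floor_iff hs0.le]; exact_mod_cast hs1.le
  have hB0 : (0 : ℝ) ≤ B := Nat.cast_nonneg B
  set D₀' : ℕ := ⌊D₀⌋₊ with hD₀'_def
  set D₁' : ℕ := ⌊D₁⌋₊ with hD₁'_def
  have hD₀'1 : 1 ≤ D₀' := by rw [hD₀'_def, Nat.le_floor_iff hD₀.le]; exact_mod_cast h1D₀
  have hD₁'1 : 1 ≤ D₁' := by rw [hD₁'_def, Nat.le_floor_iff hD₁.le]; exact_mod_cast h1D₁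
  have hD₀'le : (D₀' : ℝ) ≤ D₀ := Nat.floor_le hD₀.le
  have hD₁'le : (D₁' : ℝ) ≤ D₁ := Nat.floor_le hD₁.le
  have hdeg₀' : P.degreeOf 0 ≤ D₀' := by
    rw [hD₀'_def, Nat.le_floor_iff hD₀.le]; exact hdeg₀
  have hdeg' : ∀ h : Fin n, P.degreeOf h.succ ≤ D₁' := fun h => by
    rw [hD₁'_def, Nat.le_floor_iff hD₁.le]; exact hdeg h
  -- master inequalities for the final bounds (`c = 1`)
  have hπ3 : (3 : ℝ) < Real.pi := Real.pi_gt_three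
  have hΔ3 : (3 : ℝ) ≤ Δ := by linarith
  have hs1' : (1 : ℝ) ≤ s := hs1.le
  have hD₁0 : (0 : ℝ) ≤ D₁ := hD₁.le
  have P3 : (3 : ℝ) ≤ D₁ * Δ := by
    have := mul_le_mul h1D₁ hΔ3 (by norm_num) hD₁0; linarith
  have hK : (3 : ℝ) ≤ Δ * D₁ * s := by
    calc (3 : ℝ) = 3 * 1 := by norm_num
      _ ≤ D₁ * Δ * s := mul_le_mul P3 hs1' zero_le_one (by positivity)
      _ = Δ * D₁ * s := by ring
  have hdivπ : ∀ {X : ℝ}, 0 ≤ X → X / Real.pi ≤ X / 3 := fun hX =>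
    div_le_div_of_nonneg_left hX (by norm_num) hπ3.le
  have hBs2 : (B : ℝ) ^ 2 ≤ s ^ 2 := pow_le_pow_left₀ hB0 hBs 2
  have M1 : (1 : ℝ) ≤ 1 * Δ * D₁ ^ 2 * (S / (n + 1)) := by
    rw [← hs_def]
    calc (1 : ℝ) ≤ D₁ * 3 := by linarith
      _ ≤ D₁ * (Δ * D₁ * s) := mul_le_mul_of_nonneg_left hK hD₁0
      _ = 1 * Δ * D₁ ^ 2 * s := by ring
  have M4 : D₁ ≤ 1 * Δ * D₁ ^ 2 * (S / (n + 1)) := by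
    rw [← hs_def]
    calc D₁ = D₁ * 1 := by ring
      _ ≤ D₁ * (Δ * D₁ * s) := mul_le_mul_of_nonneg_left (by linarith) hD₁0
      _ = 1 * Δ * D₁ ^ 2 * s := by ring
  have M2 : (B : ℝ) ≤ 1 * Δ * D₁ * (S / (n + 1)) ^ 2 := by
    rw [← hs_def]
    calc (B : ℝ) ≤ s * 1 := by linarith
      _ ≤ s * (Δ * D₁ * s) := mul_le_mul_of_nonneg_left (by linarith) hs0.le
      _ = 1 * Δ * D₁ * s ^ 2 := by ring
  have M5 : D₁ ^ 2 * B * Δ / Real.pi + D₁ ≤ 1 * Δ * D₁ ^ 2 * (S / (n + 1)) := by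
    rw [← hs_def]
    have t1 : D₁ ^ 2 * B * Δ / Real.pi ≤ D₁ ^ 2 * B * Δ / 3 := hdivπ (by positivity)
    have t2 : D₁ ^ 2 * B * Δ / 3 ≤ Δ * D₁ ^ 2 * s / 3 := by
      have := mul_le_mul_of_nonneg_left hBs (by positivity : (0 : ℝ) ≤ Δ * D₁ ^ 2 / 3)
      calc D₁ ^ 2 * B * Δ / 3 = Δ * D₁ ^ 2 / 3 * B := by ring
        _ ≤ Δ * D₁ ^ 2 / 3 * s := this
        _ = Δ * D₁ ^ 2 * s / 3 := by ring
    have t3 : D₁ ≤ Δ * D₁ ^ 2 * s * (2 / 3) := by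
      calc D₁ = D₁ * 1 := by ring
        _ ≤ D₁ * (Δ * D₁ * s * (2 / 3)) := mul_le_mul_of_nonneg_left (by linarith) hD₁0
        _ = Δ * D₁ ^ 2 * s * (2 / 3) := by ring
    linarith
  have M6 : D₁ * B ^ 2 * Δ / Real.pi + B ≤ 1 * Δ * D₁ * (S / (n + 1)) ^ 2 := by
    rw [← hs_def]
    have t1 : D₁ * B ^ 2 * Δ / Real.pi ≤ D₁ * B ^ 2 * Δ / 3 := hdivπ (by positivity)
    have t2 : D₁ * B ^ 2 * Δ / 3 ≤ Δ * D₁ * s ^ 2 / 3 := by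
      have := mul_le_mul_of_nonneg_left hBs2 (by positivity : (0 : ℝ) ≤ Δ * D₁ / 3)
      calc D₁ * B ^ 2 * Δ / 3 = Δ * D₁ / 3 * (B : ℝ) ^ 2 := by ring
        _ ≤ Δ * D₁ / 3 * s ^ 2 := this
        _ = Δ * D₁ * s ^ 2 / 3 := by ring
    have t3 : (B : ℝ) ≤ Δ * D₁ * s ^ 2 * (2 / 3) := by
      calc (B : ℝ) ≤ s * 1 := by linarith
        _ ≤ s * (Δ * D₁ * s * (2 / 3)) := mul_le_mul_of_nonneg_left (by linarith) hs0.le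
        _ = Δ * D₁ * s ^ 2 * (2 / 3) := by ring
    linarith
  have M78 : D₁ ^ 2 * B ^ 2 * Δ / Real.pi + D₁ * B ≤ 1 * Δ * D₁ ^ 2 * (S / (n + 1)) ^ 2 := by
    rw [← hs_def]
    have t1 : D₁ ^ 2 * B ^ 2 * Δ / Real.pi ≤ D₁ ^ 2 * B ^ 2 * Δ / 3 := hdivπ (by positivity)
    have t2 : D₁ ^ 2 * B ^ 2 * Δ / 3 ≤ Δ * D₁ ^ 2 * s ^ 2 / 3 := by
      have := mul_le_mul_of_nonneg_left hBs2 (by positivity : (0 : ℝ) ≤ Δ * D₁ ^ 2 / 3)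
      calc D₁ ^ 2 * B ^ 2 * Δ / 3 = Δ * D₁ ^ 2 / 3 * (B : ℝ) ^ 2 := by ring
        _ ≤ Δ * D₁ ^ 2 / 3 * s ^ 2 := this
        _ = Δ * D₁ ^ 2 * s ^ 2 / 3 := by ring
    have t3 : D₁ * B ≤ Δ * D₁ ^ 2 * s ^ 2 * (2 / 3) := by
      have hb : D₁ * (B : ℝ) ≤ D₁ * s := mul_le_mul_of_nonneg_left hBs hD₁0
      calc D₁ * B ≤ D₁ * s * 1 := by linarith
        _ ≤ D₁ * s * (Δ * D₁ * s * (2 / 3)) :=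
            mul_le_mul_of_nonneg_left (by linarith) (by positivity)
        _ = Δ * D₁ ^ 2 * s ^ 2 * (2 / 3) := by ring
    linarith
  -- Step 1: the box `[0, B]^m` and the points `σ(μ)`.
  set box : Finset (Fin m → ℕ) := Fintype.piFinset fun _ : Fin m => Finset.range (B + 1) with hbox
  have hmem_box : ∀ μ : Fin m → ℕ, μ ∈ box ↔ ∀ k, μ k ≤ B := fun μ => by
    simp only [hbox, Fintype.mem_piFinset, Finset.mem_range, Nat.lt_succ_iff]
  have hcard_box : box.card = (B + 1) ^ m := by
    simp [hbox, Fintype.card_piFinset]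
  let toZ : (Fin m → ℕ) → Fin m → ℤ := fun μ k => (μ k : ℤ)
  let pt : (Fin m → ℕ) → GaGm n := fun μ => sig θ z (toZ μ)
  set Sset : Set (GaGm n) := ↑(box.image pt) with hSset
  have hSfin : Sset.Finite := Finset.finite_toSet _
  have h0box : (0 : Fin m → ℕ) ∈ box := (hmem_box 0).mpr fun k => Nat.zero_le _
  have h1S : (1 : GaGm n) ∈ Sset := by
    rw [hSset, Finset.coe_image]
    refine ⟨0, by exact_mod_cast h0box, ?_⟩
    show sig θ z (toZ 0) = 1
    have : toZ 0 = 0 := by funext k; simp [toZ]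
    rw [this, sig_zero]
  -- Step 2: `P` vanishes on `Σ₀(n+1)`.
  have hvanS : ∀ g ∈ sumset Sset (n + 1), evalAt P g = 0 := by
    rintro g ⟨σ', hσ', rfl⟩
    have hex : ∀ i, ∃ μ ∈ box, pt μ = σ' i := fun i => by
      have := hσ' i
      rw [hSset, Finset.coe_image] at this
      obtain ⟨μ, hμ, e⟩ := this
      exact ⟨μ, by exact_mod_cast hμ, e⟩
    choose μ hμbox hμeq using hex
    set Mv : Fin m → ℕ := fun k => ∑ i, μ i k with hMv
    have hMvle : ∀ k, (Mv k : ℝ) < S + 1 := fun k => by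
      have h1 : Mv k ≤ (n + 1) * B := by
        rw [hMv]
        calc ∑ i, μ i k ≤ ∑ _i : Fin (n + 1), B :=
              Finset.sum_le_sum fun i _ => (hmem_box _).mp (hμbox i) k
          _ = (n + 1) * B := by simp
      have h2 : (Mv k : ℝ) ≤ (n + 1) * B := by exact_mod_cast h1
      have h3 : ((n : ℝ) + 1) * B ≤ (n + 1) * s := mul_le_mul_of_nonneg_left hBs hn1.le
      have h4 : ((n : ℝ) + 1) * s = S := by rw [hs_def]; field_simp
      linarith
    have hprod : ∏ i, σ' i = sig θ z (toZ Mv) := by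
      have e1 : toZ Mv = ∑ i, toZ (μ i) := by
        funext k; simp [toZ, hMv]
      rw [e1, sig_sum]
      exact Finset.prod_congr rfl fun i _ => (hμeq i).symm
    rw [hprod, evalAt, sig, coord_exp]
    have e1 : (wv θ z (toZ Mv)).1 = ∑ k, (Mv k : ℂ) * θ k := by simp [wv, toZ]
    have e2 : (fun h => Complex.exp ((wv θ z (toZ Mv)).2 h)) =
        fun h => ∏ k, Complex.exp (z h k * (Mv k : ℂ)) := by
      funext h
      simp only [wv, toZ, Int.cast_natCast]
      rw [Complex.exp_sum]
      exact Finset.prod_congr rfl fun k _ => by rw [mul_comm]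
    rw [e1, e2]
    exact hvan Mv hMvle
  -- Step 3: the zero estimate, the classes of the box, decoding of a congruence.
  obtain ⟨H, ⟨g, hg⟩, hi, hii, Λ, hΛA, hΛsmall, hspan⟩ :=
    hP.vanishing hn hD₀'1 hD₁'1 hSfin h1S hP0 hdeg₀' hdeg' hvanS
  let cls : (Fin m → ℕ) → GaGm n ⧸ H.toSubgroup := fun μ => (pt μ : GaGm n ⧸ H.toSubgroup)
  have hncard : Set.ncard ((QuotientGroup.mk : GaGm n → GaGm n ⧸ H.toSubgroup) '' Sset) =
      (box.image cls).card := by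
    rw [hSset, Finset.coe_image, Set.image_image, ← Finset.coe_image, Set.ncard_coe_finset]
  rw [hncard] at hi hii
  have hmaps : ∀ μ ∈ box, cls μ ∈ box.image cls := fun μ hμ => Finset.mem_image_of_mem _ hμ
  have hcong : ∀ μ ∈ box, ∀ μ' ∈ box, cls μ = cls μ' →
      (∀ k, (|(toZ μ' - toZ μ) k| : ℝ) ≤ B) ∧
      (H.addPart = false → ∑ k, ((toZ μ' - toZ μ) k : ℂ) * θ k = 0) ∧
      ∀ χ ∈ H.chars, ∃ t : ℤ, pair z χ (toZ μ' - toZ μ) = t * (2 * Real.pi * Complex.I) := by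
    intro μ hμ μ' hμ' heq
    have hmem : sig θ z (toZ μ' - toZ μ) ∈ H.toSubgroup := by
      rw [← sig_inv_mul]; exact QuotientGroup.eq.mp heq
    rw [sig_mem_iff] at hmem
    refine ⟨fun k => ?_, hmem.1, hmem.2⟩
    have a := (hmem_box μ).mp hμ k
    have b := (hmem_box μ').mp hμ' k
    simp only [toZ, Pi.sub_apply, Int.cast_sub, Int.cast_natCast]
    rw [abs_le]
    constructor
    · have : (μ k : ℝ) ≤ B := by exact_mod_cast a
      have : (0 : ℝ) ≤ μ' k := Nat.cast_nonneg _
      linarith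
    · have : (μ' k : ℝ) ≤ B := by exact_mod_cast b
      have : (0 : ℝ) ≤ μ k := Nat.cast_nonneg _
      linarith
  have htoZ_inj : ∀ μ μ' : Fin m → ℕ, toZ μ' - toZ μ = 0 → μ = μ' := fun μ μ' h => by
    funext k
    have := congrFun h k
    simp only [toZ, Pi.sub_apply, Pi.zero_apply, sub_eq_zero] at this
    exact_mod_cast this.symm
  -- the first count: `#classes ≤ (n+1)! D₀'D₁'ⁿ < #box`, whence a congruent pair `μa ≠ μb`
  have hcount1 : (box.image cls).card < box.card := by
    have h1 : (box.image cls).card ≤ (n + 1).factorial * D₀' * D₁' ^ n := by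
      have hpos : 1 ≤ D₀' ^ H.addDim * D₁' ^ H.torusDim :=
        Nat.one_le_iff_ne_zero.mpr
          (Nat.mul_ne_zero (pow_ne_zero _ (by omega)) (pow_ne_zero _ (by omega)))
      calc (box.image cls).card ≤ (box.image cls).card * (D₀' ^ H.addDim * D₁' ^ H.torusDim) :=
            Nat.le_mul_of_pos_right _ hpos
        _ = _ := by ring
        _ ≤ _ := hi
    have h2 : ((n + 1).factorial * D₀' * D₁' ^ n : ℝ) < (B + 1 : ℝ) ^ m := by
      calc ((n + 1).factorial * D₀' * D₁' ^ n : ℝ) ≤ (n + 1).factorial * D₀ * D₁ ^ n := by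
            gcongr
        _ < s ^ m := h11a
        _ < ((B : ℝ) + 1) ^ m := pow_lt_pow_left₀ hsB hs0.le (by omega)
    have h3 : ((box.image cls).card : ℝ) < (box.card : ℝ) := by
      rw [hcard_box]; push_cast
      exact lt_of_le_of_lt (by exact_mod_cast h1) h2
    exact_mod_cast h3
  obtain ⟨μa, hμa, μb, hμb, hne, hcls⟩ :=
    Finset.exists_ne_map_eq_of_card_lt_of_maps_to hcount1 hmaps
  obtain ⟨hνB, hνθ, hνχ⟩ := hcong μa hμa μb hμb hcls
  set ν : Fin m → ℤ := toZ μb - toZ μa with hν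
  have hν0 : ν ≠ 0 := fun h0 => hne (htoZ_inj μa μb h0)
  have hZ : ∑ h, ∑ k, ‖z h k - u h * v k‖ < Real.exp (-V) := h10a
  have hZ0 : 0 ≤ ∑ h, ∑ k, ‖z h k - u h * v k‖ :=
    Finset.sum_nonneg fun h _ => Finset.sum_nonneg fun k _ => norm_nonneg _
  -- Step 4: the cases.
  cases hadd : H.addPart
  · -- Case `V = 0`: `ν.θ = 0`, so `|ν.v| ≤ B e^{-V}`; take `λ = e₁`, `μ = ν`.
    have hθ0 : ∑ k, (ν k : ℂ) * θ k = 0 := hνθ hadd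
    set e₁ : Fin n → ℤ := Pi.single ⟨0, hn⟩ 1 with he₁
    refine ⟨e₁, ν, ?_, hν0, fun i => ?_, fun k => (hνB k).trans M2, ?_⟩
    · intro h0
      have := congrFun h0 ⟨0, hn⟩
      simp [he₁] at this
    · have h1 : (|e₁ i| : ℝ) ≤ 1 := by
        rw [he₁, Pi.single_apply]; split_ifs <;> simp
      exact h1.trans M1
    · have e1 : ∑ i, (e₁ i : ℂ) * u i = u ⟨0, hn⟩ := by
        rw [Finset.sum_eq_single ⟨0, hn⟩]
        · simp [he₁]
        · intro b _ hb; simp [he₁, hb]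
        · intro h; exact absurd (Finset.mem_univ _) h
      have e2 : ∑ k, (ν k : ℂ) * v k = ∑ k, (ν k : ℂ) * (v k - θ k) := by
        simp only [mul_sub, Finset.sum_sub_distrib, hθ0, sub_zero]
      rw [e1, e2]
      have hv : ‖∑ k, (ν k : ℂ) * (v k - θ k)‖ ≤ B * Real.exp (-V) := by
        calc ‖∑ k, (ν k : ℂ) * (v k - θ k)‖ ≤ ∑ k, ‖(ν k : ℂ) * (v k - θ k)‖ := norm_sum_le _ _
          _ ≤ ∑ k, B * ‖θ k - v k‖ := Finset.sum_le_sum fun k _ => by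
              rw [norm_mul, norm_sub_rev]
              refine mul_le_mul_of_nonneg_right ?_ (norm_nonneg _)
              have : ‖(ν k : ℂ)‖ = (|ν k| : ℝ) := by simp [Complex.norm_intCast]
              rw [this]; exact hνB k
          _ = B * ∑ k, ‖θ k - v k‖ := by rw [Finset.mul_sum]
          _ ≤ B * Real.exp (-V) := mul_le_mul_of_nonneg_left h10b.le hB0
      have hu : ‖u ⟨0, hn⟩‖ ≤ Δ / Real.pi := by
        rw [le_div_iff₀ Real.pi_pos]; linarith
      have hΔπ : Δ / Real.pi * B ≤ 1 * Δ * D₁ ^ 2 * (S / (n + 1)) ^ 2 := by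
        rw [← hs_def]
        have t1 : Δ / Real.pi ≤ Δ / 3 := hdivπ hΔ.le
        have t2 : Δ / 3 * (B : ℝ) ≤ Δ / 3 * s := mul_le_mul_of_nonneg_left hBs (by positivity)
        have t3 : Δ / 3 * s ≤ Δ * D₁ ^ 2 * s ^ 2 := by
          have hD₁sq : (1 : ℝ) ≤ D₁ ^ 2 := by nlinarith
          have : (1 : ℝ) / 3 ≤ D₁ ^ 2 * s := by
            have := mul_le_mul hD₁sq hs1' zero_le_one (by positivity); linarith
          have := mul_le_mul_of_nonneg_left this (by positivity : (0 : ℝ) ≤ Δ * s)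
          calc Δ / 3 * s = Δ * s * (1 / 3) := by ring
            _ ≤ Δ * s * (D₁ ^ 2 * s) := this
            _ = Δ * D₁ ^ 2 * s ^ 2 := by ring
        have t4 := mul_le_mul_of_nonneg_right t1 hB0
        linarith
      calc ‖u ⟨0, hn⟩‖ * ‖∑ k, (ν k : ℂ) * (v k - θ k)‖ ≤ Δ / Real.pi * (B * Real.exp (-V)) :=
          mul_le_mul hu hv (norm_nonneg _) (by positivity)
        _ = Δ / Real.pi * B * Real.exp (-V) := by ring
        _ ≤ 1 * Δ * D₁ ^ 2 * (S / (n + 1)) ^ 2 * Real.exp (-V) :=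
          mul_le_mul_of_nonneg_right hΔπ (Real.exp_pos _).le
  · -- Case `V = 𝔾ₐ`. First `A ≠ 0`: otherwise `G' = G` and `P` would vanish on all of `G(ℂ)`.
    obtain ⟨lam₁, hlam₁Λ, hlam₁0⟩ : ∃ lam₁ ∈ Λ, lam₁ ≠ 0 := by
      by_contra hall
      push Not at hall
      have hcl : AddSubgroup.closure (↑Λ : Set (Fin n → ℤ)) = ⊥ := by
        rw [AddSubgroup.closure_eq_bot_iff]
        intro x hx
        exact hall x hx
      have hchars : ∀ χ ∈ H.chars, χ = 0 := fun χ hχ => by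
        obtain ⟨k, hk, hkχ⟩ := hspan χ hχ
        rw [hcl, AddSubgroup.mem_bot] at hkχ
        exact (smul_eq_zero.mp hkχ).resolve_left hk
      have hall' : ∀ x : GaGm n, x ∈ H.toSubgroup := fun x => by
        refine ⟨fun h => ?_, fun χ hχ => ?_⟩
        · rw [hadd] at h; exact absurd h (by decide)
        · rw [hchars χ hχ]; simp
      apply hP0
      refine eq_zero_of_forall_evalAt P fun x => ?_
      have := hg (g⁻¹ * x) (hall' _)
      rwa [mul_inv_cancel_left] at this
    have hlam₁A : lam₁ ∈ H.chars := hΛA hlam₁Λ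
    have hlam₁D : ∀ h, (|lam₁ h| : ℝ) ≤ D₁ := fun h =>
      le_trans (by exact_mod_cast hΛsmall lam₁ hlam₁Λ h) hD₁'le
    by_cases hindep : ∃ lam₂ ∈ Λ, lam₂ ∉ depSubgroup lam₁
    · -- Case (B1): two independent small characters; `μ = ν`.
      obtain ⟨lam₂, hlam₂Λ, hlam₂⟩ := hindep
      have hlam₂D : ∀ h, (|lam₂ h| : ℝ) ≤ D₁ := fun h =>
        le_trans (by exact_mod_cast hΛsmall lam₂ hlam₂Λ h) hD₁'le
      obtain ⟨t₁, ht₁⟩ := hνχ lam₁ hlam₁A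
      obtain ⟨t₂, ht₂⟩ := hνχ lam₂ (hΛA hlam₂Λ)
      have hT₁ := abs_t_le' (abs_t_le hlam₁D hνB hD₁0 ht₁) h10c hD₁0 hB0
      have hT₂ := abs_t_le' (abs_t_le hlam₂D hνB hD₁0 ht₂) h10c hD₁0 hB0
      obtain ⟨lam, hlam0, hlamrel, hlamB⟩ : ∃ lam : Fin n → ℤ, lam ≠ 0 ∧ pair z lam ν = 0 ∧
          ∀ h, (|lam h| : ℝ) ≤ D₁ ^ 2 * B * Δ / Real.pi + D₁ := by
        by_cases ht1 : t₁ = 0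
        · refine ⟨lam₁, hlam₁0, ?_, fun h => (hlam₁D h).trans ?_⟩
          · rw [ht₁, ht1]; simp
          · have : 0 ≤ D₁ ^ 2 * B * Δ / Real.pi := by positivity
            linarith
        · refine ⟨t₂ • lam₁ - t₁ • lam₂, ?_, ?_, fun h => ?_⟩
          · intro h0
            apply hlam₂
            refine ⟨t₂, t₁, ht1, ?_⟩
            rw [sub_eq_zero] at h0; exact h0.symm
          · rw [pair_lin_left, ht₁, ht₂]; ring
          · refine (abs_comb_le hlam₁D hlam₂D hT₁ hT₂ h).trans ?_
            have : 2 * (D₁ * B * Δ / (2 * Real.pi)) * D₁ = D₁ ^ 2 * B * Δ / Real.pi := by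
              field_simp
            rw [this]; linarith
      refine ⟨lam, ν, hlam0, hν0, fun i => (hlamB i).trans M5, fun k => (hνB k).trans M2, ?_⟩
      have hL0 : 0 ≤ D₁ ^ 2 * B * Δ / Real.pi + D₁ := by positivity
      refine (norm_mul_norm_le hlamB hνB hL0 hlamrel).trans ?_
      have h1 : (D₁ ^ 2 * B * Δ / Real.pi + D₁) * B ≤ 1 * Δ * D₁ ^ 2 * (S / (n + 1)) ^ 2 := by
        have : (D₁ ^ 2 * B * Δ / Real.pi + D₁) * B = D₁ ^ 2 * B ^ 2 * Δ / Real.pi + D₁ * B := by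
          ring
        rw [this]; exact M78
      calc (D₁ ^ 2 * B * Δ / Real.pi + D₁) * B * ∑ h, ∑ k, ‖z h k - u h * v k‖
          ≤ 1 * Δ * D₁ ^ 2 * (S / (n + 1)) ^ 2 * ∑ h, ∑ k, ‖z h k - u h * v k‖ :=
            mul_le_mul_of_nonneg_right h1 hZ0
        _ ≤ 1 * Δ * D₁ ^ 2 * (S / (n + 1)) ^ 2 * Real.exp (-V) :=
            mul_le_mul_of_nonneg_left hZ.le (by positivity)
    · -- Case (B2): `A` is cyclic, `A = ℤλ₀`; a large class gives two independent differences.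
      push Not at hindep
      have hdepA : H.chars ≤ depSubgroup lam₁ := by
        intro χ hχ
        obtain ⟨k, hk, hkχ⟩ := hspan χ hχ
        have hcl : AddSubgroup.closure (↑Λ : Set (Fin n → ℤ)) ≤ depSubgroup lam₁ :=
          (AddSubgroup.closure_le _).mpr fun x hx => hindep x hx
        exact mem_depSubgroup_of_smul lam₁ hk (hcl hkχ)
      obtain ⟨lam₀, hA⟩ := eq_zmultiples_of_saturated H.saturated hlam₁A hlam₁0 hdepA
      have hlam₀0 : lam₀ ≠ 0 := by
        rintro rfl
        have h1 : lam₁ ∈ AddSubgroup.zmultiples (0 : Fin n → ℤ) := hA ▸ hlam₁A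
        rw [AddSubgroup.mem_zmultiples_iff] at h1
        obtain ⟨k, hk⟩ := h1
        exact hlam₁0 (by rw [← hk]; simp)
      have hsumpos : 1 ≤ ∑ h, (lam₀ h).natAbs := by
        obtain ⟨h, hh⟩ : ∃ h, lam₀ h ≠ 0 := Function.ne_iff.mp hlam₀0
        calc 1 ≤ (lam₀ h).natAbs := Int.natAbs_pos.mpr hh
          _ ≤ ∑ h, (lam₀ h).natAbs :=
            Finset.single_le_sum (f := fun h => (lam₀ h).natAbs) (fun _ _ => Nat.zero_le _)
              (Finset.mem_univ h)
      -- the improved count `#classes ≤ (n+1)D₁' ≤ (n+1)D₁ < (B+1)^{m-1}`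
      have hcount2 : (box.image cls).card * (B + 1) < box.card := by
        have hii' := hii lam₀ hadd hA
        have h1 : (box.image cls).card * D₁' ^ (n - 1) * D₀' ≤ (n + 1) * D₁' ^ n * D₀' := by
          have := le_trans (Nat.mul_le_mul_left ((box.image cls).card * D₀' * D₁' ^ (n - 1))
            hsumpos) hii'
          calc (box.image cls).card * D₁' ^ (n - 1) * D₀'
              = (box.image cls).card * D₀' * D₁' ^ (n - 1) * 1 := by ring
            _ ≤ (n + 1) * D₀' * D₁' ^ n := this
            _ = (n + 1) * D₁' ^ n * D₀' := by ring
        have h2 : (box.image cls).card * D₁' ^ (n - 1) ≤ (n + 1) * D₁' * D₁' ^ (n - 1) := by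
          have := Nat.le_of_mul_le_mul_right h1 (by omega)
          have hpow : D₁' ^ n = D₁' * D₁' ^ (n - 1) := by
            rw [← pow_succ']; congr 1; omega
          calc (box.image cls).card * D₁' ^ (n - 1) ≤ (n + 1) * D₁' ^ n := this
            _ = (n + 1) * D₁' * D₁' ^ (n - 1) := by rw [hpow]; ring
        have h3 : (box.image cls).card ≤ (n + 1) * D₁' :=
          Nat.le_of_mul_le_mul_right h2 (pow_pos (by omega) _)
        have h4 : ((box.image cls).card : ℝ) < ((B : ℝ) + 1) ^ (m - 1) := by
          calc ((box.image cls).card : ℝ) ≤ (n + 1) * D₁' := by exact_mod_cast h3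
            _ ≤ (n + 1) * D₁ := mul_le_mul_of_nonneg_left hD₁'le hn1.le
            _ < s ^ (m - 1) := h11b
            _ < ((B : ℝ) + 1) ^ (m - 1) := pow_lt_pow_left₀ hsB hs0.le (by omega)
        have h5 : (box.image cls).card < (B + 1) ^ (m - 1) := by exact_mod_cast h4
        rw [hcard_box]
        calc (box.image cls).card * (B + 1) < (B + 1) ^ (m - 1) * (B + 1) :=
            Nat.mul_lt_mul_of_pos_right h5 (Nat.succ_pos B)
          _ = (B + 1) ^ m := by rw [← pow_succ]; congr 1; omega
      obtain ⟨y, -, hbig⟩ := Finset.exists_lt_card_fiber_of_mul_lt_card_of_maps_to hmaps hcount2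
      set C : Finset (Fin m → ℕ) := box.filter (fun μ => cls μ = y) with hC
      have hCbox : ∀ μ ∈ C, μ ∈ box := fun μ hμ => (Finset.mem_filter.mp hμ).1
      have hCcls : ∀ μ ∈ C, cls μ = y := fun μ hμ => (Finset.mem_filter.mp hμ).2
      obtain ⟨μ₀, hμ₀, μ₁, hμ₁, μ₂, hμ₂, hind⟩ :=
        exists_indep_of_card_gt (C := C) (B := B)
          (fun μ hμ k => (hmem_box μ).mp (hCbox μ hμ) k) hbig
      obtain ⟨hν₁B, -, hν₁χ⟩ := hcong μ₀ (hCbox _ hμ₀) μ₁ (hCbox _ hμ₁)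
        ((hCcls _ hμ₀).trans (hCcls _ hμ₁).symm)
      obtain ⟨hν₂B, -, hν₂χ⟩ := hcong μ₀ (hCbox _ hμ₀) μ₂ (hCbox _ hμ₂)
        ((hCcls _ hμ₀).trans (hCcls _ hμ₂).symm)
      set ν₁ : Fin m → ℤ := toZ μ₁ - toZ μ₀ with hν₁
      set ν₂ : Fin m → ℤ := toZ μ₂ - toZ μ₀ with hν₂
      have hind' : ∀ a b : ℤ, a • ν₁ - b • ν₂ = 0 → a = 0 ∧ b = 0 := by
        intro a b h0
        have := hind a (-b) fun k => by
          have := congrFun h0 k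
          simp only [hν₁, hν₂, toZ, Pi.sub_apply, Pi.smul_apply, smul_eq_mul,
            Pi.zero_apply] at this
          linarith
        omega
      obtain ⟨t, ht⟩ := hν₁χ lam₁ hlam₁A
      obtain ⟨t', ht'⟩ := hν₂χ lam₁ hlam₁A
      have hT := abs_t_le' (abs_t_le hlam₁D hν₁B hD₁0 ht) h10c hD₁0 hB0
      have hT' := abs_t_le' (abs_t_le hlam₁D hν₂B hD₁0 ht') h10c hD₁0 hB0
      obtain ⟨mu, hmu0, hmurel, hmuB⟩ : ∃ mu : Fin m → ℤ, mu ≠ 0 ∧ pair z lam₁ mu = 0 ∧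
          ∀ k, (|mu k| : ℝ) ≤ D₁ * B ^ 2 * Δ / Real.pi + B := by
        by_cases ht0 : t = 0
        · refine ⟨ν₁, ?_, ?_, fun k => (hν₁B k).trans ?_⟩
          · intro h0
            have := hind' 1 0 (by rw [h0]; simp)
            exact one_ne_zero this.1
          · rw [ht, ht0]; simp
          · have : 0 ≤ D₁ * B ^ 2 * Δ / Real.pi := by positivity
            linarith
        · refine ⟨t' • ν₁ - t • ν₂, ?_, ?_, fun k => ?_⟩
          · intro h0
            exact ht0 (hind' t' t h0).2
          · rw [pair_lin_right, ht, ht']; ring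
          · refine (abs_comb_le hν₁B hν₂B hT hT' k).trans ?_
            have : 2 * (D₁ * B * Δ / (2 * Real.pi)) * B = D₁ * B ^ 2 * Δ / Real.pi := by
              field_simp
            rw [this]; linarith
      refine ⟨lam₁, mu, hlam₁0, hmu0, fun i => (hlam₁D i).trans M4, fun k => (hmuB k).trans M6,
        ?_⟩
      refine (norm_mul_norm_le hlam₁D hmuB hD₁0 hmurel).trans ?_
      have h1 : D₁ * (D₁ * B ^ 2 * Δ / Real.pi + B) ≤ 1 * Δ * D₁ ^ 2 * (S / (n + 1)) ^ 2 := by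
        have : D₁ * (D₁ * B ^ 2 * Δ / Real.pi + B) = D₁ ^ 2 * B ^ 2 * Δ / Real.pi + D₁ * B := by
          ring
        rw [this]; exact M78
      calc D₁ * (D₁ * B ^ 2 * Δ / Real.pi + B) * ∑ h, ∑ k, ‖z h k - u h * v k‖
          ≤ 1 * Δ * D₁ ^ 2 * (S / (n + 1)) ^ 2 * ∑ h, ∑ k, ‖z h k - u h * v k‖ :=
            mul_le_mul_of_nonneg_right h1 hZ0
        _ ≤ 1 * Δ * D₁ ^ 2 * (S / (n + 1)) ^ 2 * Real.exp (-V) :=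
            mul_le_mul_of_nonneg_left hZ.le (by positivity)

end DiazZL

/-- **Diaz's zero lemma** (`Diaz1989_zeroLemma`, Diaz 1989, pp. 11–12) **from Philippon's zero
estimate** `Philippon1986_GaGm_P1n` (Philippon 1986, Thm 2.1 on `𝔾ₐ × 𝔾ₘⁿ ⊂ (ℙ¹)^{n+1}`).
[cite: Diaz1989, §II-3-4 Lemme de zéros, pp. 11–12] -/
theorem Diaz1989_zeroLemma_of_P1n (h : Philippon1986_GaGm_P1n) : Diaz1989_zeroLemma :=
  DiazZL.zeroLemma_of_P1n h

/-- **Diaz 1989, Théorème 1, from Philippon's two theorems of 1986** (the criterion Thm 2.11 and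
the zero estimate Thm 2.1). [cite: Diaz1989, Théorème 1, pp. 1–2] -/
theorem Diaz1989_thm1_of_philippon (hC : Philippon1986_mainCriterion)
    (hZ : Philippon1986_GaGm_P1n) : Diaz1989_thm1 :=
  Diaz1989_thm1_of_criterion hC (Diaz1989_zeroLemma_of_P1n hZ)

/-- **The Gelfond–Diaz ladder from Philippon's two theorems of 1986**:
`Philippon1986_mainCriterion → Philippon1986_GaGm_P1n → diaz_1989`
(`trdeg_ℚ ℚ(α^β, …, α^{β^{d-1}}) ≥ [(d+1)/2]`). This is the current trust base of the named fact
`diaz_1989`. [cite: Diaz1989, Corollaire 2, p. 3] -/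
theorem diaz_1989_of_philippon (hC : Philippon1986_mainCriterion) (hZ : Philippon1986_GaGm_P1n) :
    diaz_1989 :=
  diaz_1989_of_criterion hC (Diaz1989_zeroLemma_of_P1n hZ)

/-- The same for LNM 1752, Ch. 14, Thm 2.7 (`t₁`). [cite: NesterenkoPhilippon2001, Ch. 14 Thm 2.7 (t₁), p. 248] -/
theorem Diaz1989_gridX_of_philippon (hC : Philippon1986_mainCriterion)
    (hZ : Philippon1986_GaGm_P1n) : Diaz1989_gridX :=
  Diaz1989_gridX_of_criterion hC (Diaz1989_zeroLemma_of_P1n hZ)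

/-- The same for Diaz 1989, Corollaire 1. [cite: Diaz1989, Corollaire 1, p. 3] -/
theorem Diaz1989_cor1_of_philippon (hC : Philippon1986_mainCriterion)
    (hZ : Philippon1986_GaGm_P1n) : Diaz1989_cor1 :=
  Diaz1989_cor1_of_criterion hC (Diaz1989_zeroLemma_of_P1n hZ)

end Literature.NumberTheory.Transcendental

end
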